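import Literature.Analysis.FluidPDE.AncientWeakL3BackwardLiouvilleAssembly
import Literature.Analysis.FluidPDE.BoundedMildWeakL3LocalEnergySolution
import Literature.Analysis.FluidPDE.WeakL3InitialLayerEstimate
import HarnessLib

/-!
# Discharge of `AlbrittonBarker2019_liouville_weakL3_backward`

Analysis/FluidPDE proof file (theorems only): the named fact
`Literature.Analysis.FluidPDE.AlbrittonBarker2019_liouville_weakL3_backward`
(`AncientL3BackwardLiouville.lean`; D. Albritton, T. Barker, *Global weak Besov solutions of the
Navier–Stokes equations and applications*, Arch. Ration. Mech. Anal. 232 (2019) =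
arXiv:1811.00502, Thm. 4.1) is proved by feeding the assembly
`AlbrittonBarker2019_liouville_weakL3_backward_of_localEnergy_of_layer` with

* the local energy solutions generated by the time slices of the bounded ancient mild solution
  (`exists_isLocalEnergySolutionOn_of_oseenForward`, Barker–Seregin–Šverák 2016, Def. 1.1), and
* the initial layer `‖u(t) − e^{tΔ}u(0)‖_{L²(B₁(x₀))} ≤ Λ(M) t^{1/4}` of bounded mild solutions
  with weak-`L³` data (`weakL3_initial_layer`, Barker–Seregin–Šverák 2016, Lemma 3.4).

## References

* D. Albritton, T. Barker, arXiv:1811.00502, Thm. 4.1 and its proof (§4). [`AlbrittonBarker2019`]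
* T. Barker, G. Seregin, V. Šverák, arXiv:1603.03211, Def. 1.1, Lemma 3.4. [`BarkerSeregin2016`]
-/

noncomputable section

open MeasureTheory Set Function Filter Metric TopologicalSpace InnerProductSpace
open _root_.Topology
open scoped NNReal ENNReal RealInnerProductSpace

namespace Literature.Analysis.FluidPDE

open UnboundedOperators FunctionSpaces

/-- **The layer hypothesis of the assembly** (Barker–Seregin–Šverák 2016, Lemma 3.4, in the form
used by Albritton–Barker 2019, proof of Thm. 4.1): for every `M` there is `η` with `η(t) → 0` as
`t → 0⁺` such that every bounded mild solution on `[0, S]`, `S ≤ 1`, with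
`‖u(0)‖³_{L^{3,∞}} ≤ M` satisfies `‖u(t) − e^{tΔ}u(0)‖_{L²(B₁(x₀))} ≤ η(t)` for `t ∈ (0, S)` and all
`x₀` (here `η(t) = Λ(M) t^{1/4}`, and the bound even holds in `L²(ℝ³)`). [cite: BarkerSeregin2016, Lemma 3.4] -/
theorem weakL3_layer_hypothesis : ∀ M : ℝ≥0, ∃ η : ℝ → ℝ≥0, Tendsto η (𝓝[>] 0) (𝓝 0) ∧
      ∀ (S : ℝ), 0 < S → S ≤ 1 →
      ∀ u : ℝ → EuclideanSpace ℝ (Fin 3) → EuclideanSpace ℝ (Fin 3),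
        ContinuousOn (uncurry u) (Icc 0 S ×ˢ univ) →
        (∃ C : ℝ, ∀ t ∈ Icc 0 S, ∀ x, ‖u t x‖ ≤ C) →
        (∀ t ∈ Icc 0 S, IsWeaklyDivFree (u t)) →
        (∀ s t : ℝ, 0 ≤ s → s < t → t ≤ S → ∀ x,
          u t x = UnboundedOperators.heatExtension (u s) (t - s) x - oseenDuhamel 1 s u u t x) →
        FunctionSpaces.eWeakLpPow (u 0) 3 volume ≤ M →
        ∀ t ∈ Ioo 0 S, ∀ x₀ : EuclideanSpace ℝ (Fin 3),
          eLpNorm (u t - heatTest 1 (u 0) t) 2 (volume.restrict (ball x₀ 1)) ≤ η t := by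
  obtain ⟨Λ, hΛ0, hΛ⟩ := weakL3_initial_layer
  intro M
  refine ⟨fun t => Real.toNNReal (Λ M * (max t 0) ^ (1 / 4 : ℝ)), ?_, ?_⟩
  · -- `η(t) → 0` as `t → 0⁺`
    have hc : Continuous fun t : ℝ => Real.toNNReal (Λ M * (max t 0) ^ (1 / 4 : ℝ)) := by
      refine continuous_real_toNNReal.comp (continuous_const.mul ?_)
      exact continuous_iff_continuousAt.2 fun t =>
        (Real.continuousAt_rpow_const _ _ (Or.inr (by norm_num))).comp (continuous_id.max continuous_const).continuousAt
    have h := hc.tendsto 0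
    simp only [max_self, Real.zero_rpow (by norm_num : (1 / 4 : ℝ) ≠ 0), mul_zero, Real.toNNReal_zero] at h
    exact h.mono_left nhdsWithin_le_nhds
  · intro S hS hS1 u hcont hbdd hdiv hmild hM t ht x₀
    obtain ⟨hmem, hle⟩ := hΛ M S hS hS1 u hcont hbdd hdiv hmild hM t ht
    have hfun : u t - heatTest 1 (u 0) t = fun x => u t x - UnboundedOperators.heatExtension (u 0) t x := by
      funext x
      rw [Pi.sub_apply, heatTest_of_pos one_pos ht.1, one_mul]
    rw [hfun]
    calc eLpNorm (fun x => u t x - UnboundedOperators.heatExtension (u 0) t x) 2 (volume.restrict (ball x₀ 1))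
        ≤ eLpNorm (fun x => u t x - UnboundedOperators.heatExtension (u 0) t x) 2 volume :=
          eLpNorm_mono_measure _ Measure.restrict_le_self
      _ = ENNReal.ofReal ((eLpNorm (fun x => u t x - UnboundedOperators.heatExtension (u 0) t x) 2 volume).toReal) :=
          (ENNReal.ofReal_toReal hmem.2.ne).symm
      _ ≤ ENNReal.ofReal (Λ M * (max t 0) ^ (1 / 4 : ℝ)) := by
          rw [max_eq_left ht.1.le]; exact ENNReal.ofReal_le_ofReal hle
      _ = ((Real.toNNReal (Λ M * (max t 0) ^ (1 / 4 : ℝ)) : ℝ≥0) : ℝ≥0∞) := rfl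

/-- **Discharge of `AlbrittonBarker2019_liouville_weakL3_backward`** (Albritton–Barker 2019,
Thm. 4.1: a bounded ancient mild solution with a weak-`L³` sequential blow-down and a slice in
the closure of tests in `Ḃ^{-1}_{∞,∞}` vanishes up to that slice). The assembly
`AlbrittonBarker2019_liouville_weakL3_backward_of_localEnergy_of_layer` (rescaling, weak-star
compactness of the data, the global weak `L^{3,∞}` solutions of Barker–Seregin–Šverák, strong
local convergence, backward uniqueness for local Leray solutions) is fed with the local energy
solutions of the slices (`exists_isLocalEnergySolutionOn_of_oseenForward`) and the initial layer
(`weakL3_layer_hypothesis`). [cite: AlbrittonBarker2019, Thm. 4.1 (arXiv:1811.00502 §4)] -/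
theorem AlbrittonBarker2019_liouville_weakL3_backward_holds : AlbrittonBarker2019_liouville_weakL3_backward :=
  AlbrittonBarker2019_liouville_weakL3_backward_of_localEnergy_of_layer
    (fun S hS u hcont hbdd hdiv hmild h0 =>
      exists_isLocalEnergySolutionOn_of_oseenForward S hS u hcont hbdd hdiv hmild h0)
    weakL3_layer_hypothesis

end Literature.Analysis.FluidPDE

end
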